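import Summits.ResolutionOfSingularities.ResolutionOfSingularities.Theorems.EquisingularLiftEquisingularLiftNatQuasiRegularPairLocal
import Summits.ResolutionOfSingularities.ResolutionOfSingularities.Theorems.EquisingularLiftEquisingularLiftNatDirectionOfChartFamily
import Summits.ResolutionOfSingularities.ResolutionOfSingularities.Theorems.WeightedInvariantQuasiRegularLocalToGlobal
import Literature.AlgebraicGeometry.Resolution.IdealSheafFlatDescent
import HarnessLib

/-!
# [OURS · L1 W4.5(b) · EL♮(3) · S6 (L) brick C2, sub-brick B1′] Adapted affine frames of the carrier trace `Ī` along a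
# direction `𝒟'`

Crux chain w45b (cell `res-hironaka`), child EL♮(3) = stmt-ResolutionOfSingularities-20148; S6 (L) brick C2 of res-L1-w45b-stub-4's
`Tower.hLift_of_bricks`, sub-brick B1′ of res-type-027 g15's cut (`L/res-type-027/B1prime-AdaptedFrame.sig.lean` ec2273d21c04e91d,
signature VERBATIM). DOWNSTAIRS and `G₀`-intrinsic: the socket's stalk frames `Ī_z = (c₀, c₁)` (quasi-regular,
`𝒟'_z = (c₀) + (c₁²)`) spread to SECTIONS over an affine neighbourhood `W` inside any given open `O ∋ z`:
`Ī(W) = (c₀, c₁)`, `c` quasi-regular IN `Γ(G₀, W)`, `𝒟'(W) = (c₀) + Ī(W)²` (`exists_affine_adaptedFrame`).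

Proof. Sections `g` of the stalk frame on an affine `V ⊆ O`; the chart models `(g)~` and `((g₀) + Ī(V)²)~` (tree
`Lib/ReesAlgebraGlue`, `stalkIdeal_chartModel_family`) have the stalks of `Ī` resp. `𝒟'` AT `z`, hence on a neighbourhood
(`exists_nhd_forall_stalkIdeal_le`); on an affine `W` inside it the two ideal equalities follow stalkwise
(`mem_ideal_iff_forall_germ_mem_stalkIdeal`, `ideal_map_idealSheafOnOpen`); quasi-regularity of `g|_W` in `Γ(G₀, W)` is local at
the closed points (`isQuasiRegular_of_isLocalization_maximal`), where it follows from the socket's quasi-regular frame of the same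
stalk ideal by `IsQuasiRegular.of_span_pair_eq` (p586453). Written by res-L1-w45b-stub-3 g7. OURS; NOT a statement of any
manuscript; AI-written, weaker than expert review. No `sorry`; standard axioms; DEF-FREE.
`--supports stmt-ResolutionOfSingularities-20148 --as helper`. [cite: Matsumura1987, §16 Definition p. 124]
[cite: Hartshorne1977, Ch. II Prop. 5.4] (index only).
-/

set_option linter.dupNamespace false -- mandated namespace `Summit.<Summit>.<Problem>` of this single-conjunct summit

noncomputable section

open CategoryTheory AlgebraicGeometry TopologicalSpace IsLocalRing
open Literature.AlgebraicGeometry.Resolution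
open Literature.AlgebraicGeometry.Hironaka2017.S02Preliminaries
open AlgebraicGeometry.Scheme.IdealSheafData

namespace Summit.ResolutionOfSingularities.ResolutionOfSingularities.Cruxes.EquisingularLiftNat.Sections

/-- **Ideals on an affine open are determined by the stalks at its points.** [cite: Hartshorne1977, Ch. II Prop. 5.4] -/
theorem ideal_eq_of_forall_stalkIdeal_eq_on {X : Scheme.{0}} (A B : X.IdealSheafData) (W : X.affineOpens)
    (h : ∀ (y : X) (hy : y ∈ (W : X.Opens)), stalkIdeal A y = stalkIdeal B y) : A.ideal W = B.ideal W := by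
  apply le_antisymm
  · intro t ht
    rw [mem_ideal_iff_forall_germ_mem_stalkIdeal] at ht ⊢
    exact fun y hy => h y hy ▸ ht y hy
  · intro t ht
    rw [mem_ideal_iff_forall_germ_mem_stalkIdeal] at ht ⊢
    exact fun y hy => (h y hy).symm ▸ ht y hy

/-- **B1′ — adapted affine frames.** `G₀` locally Noetherian, `Ī`, `𝒟'` ideal sheaves with the direction frames of the socket at every
point of `supp Ī` (`hdir'` verbatim, with `Ī` for `𝓘⟨Z₀⟩`). Then every `z ∈ supp Ī` has, inside any open `O ∋ z`, an AFFINE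
neighbourhood `W` with sections `c₀, c₁ ∈ Γ(G₀, W)` such that `Ī(W) = (c₀, c₁)`, `c` is quasi-regular in `Γ(G₀, W)`, and
`𝒟'(W) = (c₀) + Ī(W)²`. [OURS · L1 W4.5b · S6 (L) C2 B1′; signature of res-type-027 g15] -/
theorem exists_affine_adaptedFrame {G₀ : Scheme.{0}} [IsLocallyNoetherian G₀] (Ī 𝒟' : G₀.IdealSheafData)
    (hdir' : ∀ z ∈ Ī.support, ∃ c : Fin 2 → G₀.presheaf.stalk z,
      Ideal.span (Set.range c) = stalkIdeal Ī z ∧ IsQuasiRegular c ∧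
      stalkIdeal 𝒟' z = Ideal.span {c 0} ⊔ Ideal.span {c 1 * c 1})
    (z : G₀) (hz : z ∈ Ī.support) (O : G₀.Opens) (hzO : z ∈ O) :
    ∃ (W : G₀.affineOpens) (_ : z ∈ (W : G₀.Opens)) (_ : (W : G₀.Opens) ≤ O) (c : Fin 2 → Γ(G₀, (W : G₀.Opens))),
      Ideal.span (Set.range c) = Ī.ideal W ∧ IsQuasiRegular c ∧
      𝒟'.ideal W = Ideal.span {c 0} ⊔ (Ī.ideal W) ^ 2 := by
  classical
  obtain ⟨c, hcspan, hcqr, hc𝒟⟩ := hdir' z hz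
  -- sections with the prescribed germs on an affine `V ⊆ O`
  obtain ⟨U₀, hzU₀, s₀, hs₀⟩ := G₀.presheaf.exists_germ_eq (c 0)
  obtain ⟨U₁, hzU₁, s₁, hs₁⟩ := G₀.presheaf.exists_germ_eq (c 1)
  obtain ⟨V', hV', hzV, hVle⟩ :=
    exists_isAffineOpen_mem_and_subset (X := G₀) (x := z) (U := O ⊓ (U₀ ⊓ U₁)) ⟨hzO, hzU₀, hzU₁⟩
  let V : G₀.affineOpens := ⟨V', hV'⟩
  have hVO : (V : G₀.Opens) ≤ O := fun p hp => (hVle hp).1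
  have hVU₀ : (V : G₀.Opens) ≤ U₀ := fun p hp => (hVle hp).2.1
  have hVU₁ : (V : G₀.Opens) ≤ U₁ := fun p hp => (hVle hp).2.2
  let g : Fin 2 → Γ(G₀, (V : G₀.Opens)) :=
    ![G₀.presheaf.map (homOfLE hVU₀).op s₀, G₀.presheaf.map (homOfLE hVU₁).op s₁]
  have hg : (fun j => (G₀.presheaf.germ (V : G₀.Opens) z hzV).hom (g j)) = c := by
    funext j
    fin_cases j
    · change (G₀.presheaf.germ (V : G₀.Opens) z hzV).hom (G₀.presheaf.map (homOfLE hVU₀).op s₀) = c 0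
      rw [TopCat.Presheaf.germ_res_apply]
      exact hs₀
    · change (G₀.presheaf.germ (V : G₀.Opens) z hzV).hom (G₀.presheaf.map (homOfLE hVU₁).op s₁) = c 1
      rw [TopCat.Presheaf.germ_res_apply]
      exact hs₁
  have hg0 : (G₀.presheaf.germ (V : G₀.Opens) z hzV).hom (g 0) = c 0 := congrFun hg 0
  -- the chart models and their stalks
  set N := (Hironaka2005.idealSheafOnOpen V (Ideal.span (Set.range g))).map (V : G₀.Opens).ι with hNdef
  set M := (Hironaka2005.idealSheafOnOpen V (Ideal.span {g 0} ⊔ Ī.ideal V ^ 2)).map (V : G₀.Opens).ι with hMdef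
  have hN : ∀ (y : G₀) (hy : y ∈ (V : G₀.Opens)),
      stalkIdeal N y = Ideal.span (Set.range fun j => (G₀.presheaf.germ (V : G₀.Opens) y hy).hom (g j)) := by
    intro y hy
    rw [hNdef, stalkIdeal_map_idealSheafOnOpen V _ hy, Ideal.map_span, ← Set.range_comp]
    rfl
  have hM : ∀ (y : G₀) (hy : y ∈ (V : G₀.Opens)),
      stalkIdeal M y = Ideal.span {(G₀.presheaf.germ (V : G₀.Opens) y hy).hom (g 0)} ⊔ stalkIdeal Ī y ^ 2 :=
    fun y hy => stalkIdeal_chartModel_family Ī (fun _ : Unit => V) (fun _ => g 0) () hy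
  have hNz : stalkIdeal N z = stalkIdeal Ī z := by rw [hN z hzV, hg, hcspan]
  have hMz : stalkIdeal M z = stalkIdeal 𝒟' z := by
    rw [hM z hzV, hg0, ← hcspan, span_singleton_sup_sq_span_pair c, hc𝒟]
  -- spread the two stalk equalities to a neighbourhood, and pick an affine `W` inside it
  obtain ⟨O₁, hzO₁, hO₁⟩ := exists_nhd_forall_stalkIdeal_le hNz.le
  obtain ⟨O₂, hzO₂, hO₂⟩ := exists_nhd_forall_stalkIdeal_le hNz.ge
  obtain ⟨O₃, hzO₃, hO₃⟩ := exists_nhd_forall_stalkIdeal_le hMz.le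
  obtain ⟨O₄, hzO₄, hO₄⟩ := exists_nhd_forall_stalkIdeal_le hMz.ge
  obtain ⟨W', hW', hzW, hWle⟩ := exists_isAffineOpen_mem_and_subset (X := G₀) (x := z)
    (U := (V : G₀.Opens) ⊓ (O₁ ⊓ O₂) ⊓ (O₃ ⊓ O₄)) ⟨⟨hzV, hzO₁, hzO₂⟩, hzO₃, hzO₄⟩
  let W : G₀.affineOpens := ⟨W', hW'⟩
  have hWV : (W : G₀.Opens) ≤ V := fun p hp => (hWle hp).1.1
  have hWO₁ : (W : G₀.Opens) ≤ O₁ := fun p hp => (hWle hp).1.2.1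
  have hWO₂ : (W : G₀.Opens) ≤ O₂ := fun p hp => (hWle hp).1.2.2
  have hWO₃ : (W : G₀.Opens) ≤ O₃ := fun p hp => (hWle hp).2.1
  have hWO₄ : (W : G₀.Opens) ≤ O₄ := fun p hp => (hWle hp).2.2
  let gW : Fin 2 → Γ(G₀, (W : G₀.Opens)) := fun j => G₀.presheaf.map (homOfLE hWV).op (g j)
  have hgerm : ∀ (y : G₀) (hy : y ∈ (W : G₀.Opens)) (j : Fin 2),
      (G₀.presheaf.germ (W : G₀.Opens) y hy).hom (gW j) = (G₀.presheaf.germ (V : G₀.Opens) y (hWV hy)).hom (g j) :=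
    fun y hy j => TopCat.Presheaf.germ_res_apply G₀.presheaf (homOfLE hWV) y hy (g j)
  have hĪy : ∀ (y : G₀) (hy : y ∈ (W : G₀.Opens)),
      stalkIdeal Ī y = Ideal.span (Set.range fun j => (G₀.presheaf.germ (W : G₀.Opens) y hy).hom (gW j)) := by
    intro y hy
    rw [le_antisymm (hO₂ y (hWO₂ hy)) (hO₁ y (hWO₁ hy)), hN y (hWV hy)]
    simp_rw [hgerm y hy]
  have h𝒟y : ∀ (y : G₀) (hy : y ∈ (W : G₀.Opens)),
      stalkIdeal 𝒟' y = Ideal.span {(G₀.presheaf.germ (W : G₀.Opens) y hy).hom (gW 0)} ⊔ stalkIdeal Ī y ^ 2 := by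
    intro y hy
    rw [le_antisymm (hO₄ y (hWO₄ hy)) (hO₃ y (hWO₃ hy)), hM y (hWV hy), hgerm y hy]
  -- the two ideal equalities on `W`
  have hIW : Ī.ideal W = Ideal.span (Set.range gW) := by
    have hNW : ∀ (y : G₀) (hy : y ∈ (W : G₀.Opens)), stalkIdeal Ī y =
        stalkIdeal ((Hironaka2005.idealSheafOnOpen W (Ideal.span (Set.range gW))).map (W : G₀.Opens).ι) y := by
      intro y hy
      rw [hĪy y hy, stalkIdeal_map_idealSheafOnOpen W _ hy, Ideal.map_span, ← Set.range_comp]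
      rfl
    rw [ideal_eq_of_forall_stalkIdeal_eq_on Ī _ W hNW, ideal_map_idealSheafOnOpen]
  have h𝒟W : 𝒟'.ideal W = Ideal.span {gW 0} ⊔ (Ī.ideal W) ^ 2 := by
    have hMW : ∀ (y : G₀) (hy : y ∈ (W : G₀.Opens)), stalkIdeal 𝒟' y =
        stalkIdeal ((Hironaka2005.idealSheafOnOpen W (Ideal.span {gW 0} ⊔ Ī.ideal W ^ 2)).map (W : G₀.Opens).ι) y := by
      intro y hy
      rw [h𝒟y y hy, stalkIdeal_chartModel_family Ī (fun _ : Unit => W) (fun _ => gW 0) () hy]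
    rw [ideal_eq_of_forall_stalkIdeal_eq_on 𝒟' _ W hMW, ideal_map_idealSheafOnOpen]
  -- quasi-regularity of `gW` in `Γ(G₀, W)`: local at the closed points of `W`
  have hfrom : ∀ (P : Ideal Γ(G₀, (W : G₀.Opens))) [P.IsPrime], W.2.fromSpec.base ⟨P, inferInstance⟩ ∈ (W : G₀.Opens) :=
    fun P _ => W.2.range_fromSpec.le ⟨_, rfl⟩
  have hqr : IsQuasiRegular gW := by
    refine Summit.ResolutionOfSingularities.ResolutionOfSingularities.Theorems.isQuasiRegular_of_isLocalization_maximal gW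
      (fun P _ => G₀.presheaf.stalk (W.2.fromSpec.base ⟨P, inferInstance⟩)) (fun P _ => inferInstance)
      (fun P _ => (G₀.presheaf.germ (W : G₀.Opens) _ (hfrom P)).hom.toAlgebra)
      (fun P _ => W.2.isLocalization_stalk' ⟨P, inferInstance⟩ (hfrom P)) ?_
    intro P hP hle
    set y : G₀ := W.2.fromSpec.base ⟨P, hP.isPrime⟩ with hydef
    have hy : y ∈ (W : G₀.Opens) := hfrom P
    letI : Algebra Γ(G₀, (W : G₀.Opens)) (G₀.presheaf.stalk y) := (G₀.presheaf.germ (W : G₀.Opens) y hy).hom.toAlgebra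
    haveI : IsLocalization.AtPrime (G₀.presheaf.stalk y) P := W.2.isLocalization_stalk' ⟨P, hP.isPrime⟩ hy
    -- `Ī_y = (germ gW) ⊆ 𝔪_y`, so `y ∈ supp Ī`
    have hspan_y : Ideal.span (Set.range (algebraMap Γ(G₀, (W : G₀.Opens)) (G₀.presheaf.stalk y) ∘ gW)) = stalkIdeal Ī y := by
      rw [hĪy y hy]; rfl
    have hle_y : stalkIdeal Ī y ≤ maximalIdeal _ := by
      rw [← hspan_y, Ideal.span_le]
      rintro _ ⟨j, rfl⟩
      exact (IsLocalization.AtPrime.to_map_mem_maximal_iff (G₀.presheaf.stalk y) P (gW j)).mpr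
        (hle (Ideal.subset_span ⟨j, rfl⟩))
    have hyS : y ∈ Ī.support := (mem_support_iff_stalkIdeal_le Ī y).mpr hle_y
    obtain ⟨c', hc'span, hc'qr, -⟩ := hdir' y hyS
    exact IsQuasiRegular.of_span_pair_eq hc'qr (hc'span ▸ hle_y) (hspan_y.trans hc'span.symm)
  exact ⟨W, hzW, hWV.trans hVO, gW, hIW.symm, hqr, h𝒟W⟩

end Summit.ResolutionOfSingularities.ResolutionOfSingularities.Cruxes.EquisingularLiftNat.Sections

end
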